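import Mathlib
import HarnessLib
import Summits.ValiantsHypothesis.ValiantsHypothesis.Theorems.MonotoneRestorationOrbitRestorationQPHomTensorEigen
import Summits.ValiantsHypothesis.ValiantsHypothesis.Theorems.MonotoneRestorationOrbitRestorationQPExplicitForm
import Summits.ValiantsHypothesis.ValiantsHypothesis.Theorems.MonotoneRestorationOrbitRestorationQPExplicitToPDClass

/-!
# The Kronecker substitution (tensoring with a fixed weighted target) preserves the depth-three slice `PDClass 1`
# (route MonotoneRestoration, crux `OrbitRestorationQP` stmt-ValiantsHypothesis-18293; TW-LB programme for the rung A_∞, piece R9b″)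

Namespace `Summit.ValiantsHypothesis.ValiantsHypothesis.Theorems.HomTensor`.  Definition-free.

`…HomTensorEigen.lean`: the substitution `κ_{e,z} : x_{pq} ↦ z_{(e p).2,(e q).2} · x_{(e p).1,(e q).1}` (`e : Fin N ≃ Fin n × Fin m`, `z` a fixed
`m × m` matrix of scalars) acts diagonally on homomorphism polynomials.  For the isolation step of TW-LB (memo CLOSURE-RESIDUE-g9 §6)
it must also preserve "polynomial-size `ΣΠΣ`": it does, since it maps affine forms to affine forms and explicit depth-three data
(`ExplicitForm.exists_explicit_of_pdClassOne`) to explicit data of the same shape (`ExplicitForm.pdClass_one_of_explicit`):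

* `totalDegree_aeval_le_of_le_one` — substituting polynomials of total degree `≤ 1` for the variables does not raise the total degree;
* `pdClassOne_kronecker` — **for every `c, m` there is `c'` with: `m ≤ n`, `e : Fin N ≃ Fin n × Fin m`, `p ∈ PDClass (fun _ => 1) N c`
  `⟹ κ_{e,z}(p) ∈ PDClass (fun _ => 1) n c'`** (all `z`).

Honest label: bookkeeping; no stub closed; VP ≠ VNP untouched. [folklore] [cite: Lovasz1967, §2]
-/

noncomputable section

open scoped Classical

-- `Summit.ValiantsHypothesis.ValiantsHypothesis.…` is the tree's single-conjunct layout (Sub = Summit).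
set_option linter.dupNamespace false

namespace Summit.ValiantsHypothesis.ValiantsHypothesis.Theorems.HomTensor

open MvPolynomial Literature.Computability.AlgebraicComplexity OrbitRestorationQPDepthThreeRung

/-- **Substituting affine forms does not raise the total degree.** [folklore] -/
theorem totalDegree_aeval_le_of_le_one {σ τ R : Type*} [CommSemiring R] (φ : σ → MvPolynomial τ R)
    (hφ : ∀ i, (φ i).totalDegree ≤ 1) (f : MvPolynomial σ R) :
    (aeval φ f).totalDegree ≤ f.totalDegree := by
  classical
  conv_lhs => rw [f.as_sum]
  rw [map_sum]
  refine (totalDegree_finsetSum _ _).trans (Finset.sup_le fun d hd => ?_)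
  rw [aeval_monomial, algebraMap_eq]
  refine (totalDegree_mul _ _).trans ?_
  rw [totalDegree_C, zero_add, Finsupp.prod]
  refine (totalDegree_finsetProd _ _).trans ?_
  refine le_trans (Finset.sum_le_sum fun i _ => (totalDegree_pow _ _).trans (Nat.mul_le_mul_left _ (hφ i))) ?_
  simp only [mul_one]
  exact le_totalDegree hd

/-- The Kronecker substitution sends variables to polynomials of total degree `≤ 1`. [folklore] -/
theorem totalDegree_kroneckerVar_le {N n m : ℕ} (e : Fin N ≃ Fin n × Fin m) (z : Fin m × Fin m → ℂ) (pq : Fin N × Fin N) :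
    (C (z ((e pq.1).2, (e pq.2).2)) * X ((e pq.1).1, (e pq.2).1) : MvPolynomial (Fin n × Fin n) ℂ).totalDegree ≤ 1 :=
  (totalDegree_mul _ _).trans (by rw [totalDegree_C, totalDegree_X, zero_add])

/-- Arithmetic for the level change `N = n·m ≤ n²`. [folklore] -/
theorem pbound_prod_le {n m c : ℕ} (hmn : m ≤ n) :
    (n * m) ^ (c + 2) + (c + 2) ≤ n ^ (3 * c + 6) + (3 * c + 6) := by
  have h1 : (n * m) ^ (c + 2) ≤ (n * n) ^ (c + 2) := Nat.pow_le_pow_left (Nat.mul_le_mul_left _ hmn) _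
  have h2 : (n * n) ^ (c + 2) = n ^ (2 * c + 4) := by rw [← pow_two, ← pow_mul]; ring_nf
  rcases Nat.eq_zero_or_pos n with rfl | hn
  · simp; omega
  · have h3 : n ^ (2 * c + 4) ≤ n ^ (3 * c + 6) := Nat.pow_le_pow_right hn (by omega)
    omega

/-- **THE KRONECKER SUBSTITUTION PRESERVES THE DEPTH-THREE SLICE.**  For every `c, m` there is `c'` such that for all levels
`N, n` with `m ≤ n`, every bijection `e : Fin N ≃ Fin n × Fin m`, every weight matrix `z`, and every `p ∈ PDClass (fun _ => 1) N c`,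
the substituted polynomial `κ_{e,z}(p)` lies in `PDClass (fun _ => 1) n c'`. [folklore] -/
theorem pdClassOne_kronecker (c m : ℕ) : ∃ c' : ℕ, ∀ (N n : ℕ) (e : Fin N ≃ Fin n × Fin m) (z : Fin m × Fin m → ℂ)
    (p : MvPolynomial (Fin N × Fin N) ℂ), m ≤ n → PDClass (fun _ => 1) N c p →
    PDClass (fun _ => 1) n c'
      (aeval (fun pq : Fin N × Fin N =>
        (C (z ((e pq.1).2, (e pq.2).2)) * X ((e pq.1).1, (e pq.2).1) : MvPolynomial (Fin n × Fin n) ℂ)) p) := by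
  refine ⟨2 * (2 * (3 * c + 6) + 8) + 3 ^ (2 * (3 * c + 6) + 8), fun N n e z p hmn hPD => ?_⟩
  obtain ⟨k, a, L, hdeg, hk, hcard, hp⟩ := ExplicitForm.exists_explicit_of_pdClassOne hPD
  have hN : N = n * m := by
    have := Fintype.card_congr e
    simpa [Fintype.card_fin, Fintype.card_prod] using this
  have hb : N ^ (c + 2) + (c + 2) ≤ n ^ (3 * c + 6) + (3 * c + 6) := by rw [hN]; exact pbound_prod_le hmn
  set κ : MvPolynomial (Fin N × Fin N) ℂ →ₐ[ℂ] MvPolynomial (Fin n × Fin n) ℂ :=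
    aeval (fun pq : Fin N × Fin N =>
      (C (z ((e pq.1).2, (e pq.2).2)) * X ((e pq.1).1, (e pq.2).1) : MvPolynomial (Fin n × Fin n) ℂ)) with hκ
  have himg : κ p = ∑ i : Fin k, C (a i) * ((L i).map κ).prod := by
    rw [hp, map_sum]
    refine Finset.sum_congr rfl fun i _ => ?_
    rw [map_mul, map_multiset_prod, hκ, algHom_C, algebraMap_eq]
  rw [himg]
  refine ExplicitForm.pdClass_one_of_explicit (𝒯 := Fin k) (by rw [Fintype.card_fin]; exact hk.trans hb) a
    (fun i => (L i).map κ) (fun i ℓ hℓ => ?_) (fun i => by rw [Multiset.card_map]; exact (hcard i).trans hb)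
  obtain ⟨ℓ₀, hℓ₀, rfl⟩ := Multiset.mem_map.mp hℓ
  exact (totalDegree_aeval_le_of_le_one _ (totalDegree_kroneckerVar_le e z) ℓ₀).trans (hdeg i ℓ₀ hℓ₀)

end Summit.ValiantsHypothesis.ValiantsHypothesis.Theorems.HomTensor

end
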